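import Summits.ABC.ABC.Theorems.IneffectiveSubspaceDeepRegimeABCOmegaTail

/-!
# `DeepRegimeABC` (stmt-ABC-15121): constant-free normal form, and the collapse of the exp-`ω` shape

Two more normal-form facts for the crux `Summit.ABC.ABC.Theses.IneffectiveSubspace.DeepRegimeABC`
(line `Sketch`, card `omega-collapse`), over existing declarations only:

* `deepRegimeABC_iff_constFree` — the constant `C` of the crux is not load-bearing: the crux is
  equivalent to its `C = 1` form "for every `ε > 0` there is `K` with `c < rad(abc)^(1+ε)` for every abc
  triple with `ω₅(abc) ≥ K`" (on the tail `rad(abc) ≥ ω(abc)!` absorbs any constant).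
* `expOmegaBound_iff_abc` — HONEST ACCOUNTING for the absorption theorem
  `deepRegimeABC_of_expOmegaBound` of the previous file: an abc bound with simply-exponential loss in
  `ω(abc)` for ALL triples, `∀ ε ∃ A C, c < C·e^{A·ω(abc)}·rad^(1+ε)`, is not an intermediate target but
  `ABC` itself (on each bounded-`ω` cell the loss is a constant, on the tail it is absorbed) — so, like
  every fixed-threshold variant, it cannot serve as a strictly weaker milestone; only `ε`-dependent
  thresholds (the crux) sit strictly between.
-/

-- `Summit.<Summit>.<Problem>` is the mandated summit-side namespace (CONVENTIONS §2); for the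
-- single-conjunct summit `ABC` the two coincide, so the duplicate `ABC.ABC` is deliberate.
set_option linter.dupNamespace false

namespace Summit.ABC.ABC.Theorems.DeepRegimeABC

open Literature.NumberTheory.DiophantineGeometry UniqueFactorizationMonoid
open Summit.ABC.ABC.Theses.IneffectiveSubspace

/-- A positive constant is absorbed on the tail: for `C > 0`, `ε > 0` there is `W ≥ 1` with
`C ≤ rad(n)^ε` whenever `ω(n) ≥ W`. [folklore] -/
theorem const_le_radical_rpow {C ε : ℝ} (hC : 0 < C) (hε : 0 < ε) :
    ∃ W : ℕ, 1 ≤ W ∧ ∀ n : ℕ, W ≤ n.primeFactors.card → C ≤ ((radical n : ℕ) : ℝ) ^ ε := by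
  obtain ⟨W, hW⟩ := exp_mul_card_primeFactors_le_radical_rpow (le_max_right (Real.log C) 0) hε
  refine ⟨max W 1, le_max_right _ _, fun n hn => ?_⟩
  have hWn : W ≤ n.primeFactors.card := le_trans (le_max_left _ _) hn
  have h1n : (1 : ℝ) ≤ n.primeFactors.card := by exact_mod_cast le_trans (le_max_right _ _) hn
  calc C = Real.exp (Real.log C) := (Real.exp_log hC).symm
    _ ≤ Real.exp (max (Real.log C) 0 * n.primeFactors.card) := by
        apply Real.exp_le_exp.mpr
        calc Real.log C ≤ max (Real.log C) 0 := le_max_left _ _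
          _ = max (Real.log C) 0 * 1 := (mul_one _).symm
          _ ≤ max (Real.log C) 0 * n.primeFactors.card :=
              mul_le_mul_of_nonneg_left h1n (le_max_right _ _)
    _ ≤ ((radical n : ℕ) : ℝ) ^ ε := hW n hWn

/-- **Constant-free normal form.** The crux `DeepRegimeABC` is equivalent to its `C = 1` form: for every
`ε > 0` there is `K` such that every abc triple with `ω₅(abc) ≥ K` satisfies `c < rad(abc)^(1+ε)`
(apply the crux at `ε/2` and absorb its constant into `rad^(ε/2)`, using `ω(abc) ≥ ω₅(abc) ≥ K`).
[folklore] -/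
theorem deepRegimeABC_iff_constFree : Summit.ABC.ABC.Theses.IneffectiveSubspace.DeepRegimeABC ↔
    ∀ ε : ℝ, 0 < ε → ∃ K : ℕ, ∀ a b c : ℕ,
      Literature.NumberTheory.DiophantineGeometry.IsABCTriple a b c →
      K ≤ ((a * b * c).primeFactors.filter (fun p => 5 ≤ (a * b * c).factorization p)).card →
      (c : ℝ) < ((Literature.NumberTheory.DiophantineGeometry.rad a b c : ℕ) : ℝ) ^ (1 + ε) := by
  constructor
  · intro h ε hε
    obtain ⟨K₀, C, hC, hK₀⟩ := h (ε / 2) (half_pos hε)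
    obtain ⟨W, -, hW⟩ := const_le_radical_rpow hC (half_pos hε)
    refine ⟨max K₀ W, fun a b c habc hK => ?_⟩
    have hlt := hK₀ a b c habc (le_trans (le_max_left _ _) hK)
    have hω : W ≤ (a * b * c).primeFactors.card :=
      le_trans (le_trans (le_max_right _ _) hK) (Finset.card_filter_le _ _)
    have hradR : ((rad a b c : ℕ) : ℝ) = ((radical (a * b * c) : ℕ) : ℝ) := by rw [rad_def]
    have hrad_pos : (0 : ℝ) < ((rad a b c : ℕ) : ℝ) := by
      rw [hradR]; exact_mod_cast Nat.pos_of_ne_zero radical_ne_zero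
    have hCle : C ≤ ((rad a b c : ℕ) : ℝ) ^ (ε / 2) := by rw [hradR]; exact hW _ hω
    have h0 : (0 : ℝ) ≤ ((rad a b c : ℕ) : ℝ) ^ (1 + ε / 2) := Real.rpow_nonneg hrad_pos.le _
    calc (c : ℝ) < C * ((rad a b c : ℕ) : ℝ) ^ (1 + ε / 2) := hlt
      _ ≤ ((rad a b c : ℕ) : ℝ) ^ (ε / 2) * ((rad a b c : ℕ) : ℝ) ^ (1 + ε / 2) :=
          mul_le_mul_of_nonneg_right hCle h0
      _ = ((rad a b c : ℕ) : ℝ) ^ (1 + ε) := by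
          rw [← Real.rpow_add hrad_pos]; ring_nf
  · intro h ε hε
    obtain ⟨K, hK⟩ := h ε hε
    exact ⟨K, 1, one_pos, fun a b c habc hKle => by simpa using hK a b c habc hKle⟩

/-- **The exp-`ω` shape for all triples is `ABC` itself.** An abc bound with a simply-exponential loss
in the number of primes, `∀ ε ∃ A C ∀ abc triples, c < C·e^{A·ω(abc)}·rad(abc)^(1+ε)`, is EQUIVALENT to
`ABC`: it gives the crux by absorption (`deepRegimeABC_of_expOmegaBound`) and abc on every bounded-`ω`
cell with the constant `C·e^{A⁺W}`, and these two are `ABC` (`abc_iff_deepRegimeABC_and_boundedOmega`).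
So Baker-type `ω`-refinements (e.g. `c < κ(ε^{-ω}·rad)^(1+ε)`) are refinements OF abc, never milestones
strictly below it; the only statements strictly between sit at `ε`-dependent thresholds. [folklore] -/
theorem expOmegaBound_iff_abc :
    (∀ ε : ℝ, 0 < ε → ∃ A C : ℝ, 0 < C ∧ ∀ a b c : ℕ, IsABCTriple a b c →
      (c : ℝ) < C * Real.exp (A * (a * b * c).primeFactors.card) *
        ((rad a b c : ℕ) : ℝ) ^ (1 + ε)) ↔ _root_.ABC := by
  constructor
  · intro h
    refine abc_iff_deepRegimeABC_and_boundedOmega.mpr ⟨deepRegimeABC_of_expOmegaBound h, ?_⟩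
    intro W ε hε
    obtain ⟨A, C, hC, hAC⟩ := h ε hε
    refine ⟨C * Real.exp (max A 0 * W), by positivity, fun a b c habc hω => ?_⟩
    have h0 : (0 : ℝ) ≤ ((rad a b c : ℕ) : ℝ) ^ (1 + ε) := Real.rpow_nonneg (Nat.cast_nonneg _) _
    have hexp : Real.exp (A * (a * b * c).primeFactors.card) ≤ Real.exp (max A 0 * W) := by
      apply Real.exp_le_exp.mpr
      have hωR : ((a * b * c).primeFactors.card : ℝ) ≤ W := by exact_mod_cast hω
      calc A * (a * b * c).primeFactors.card ≤ max A 0 * (a * b * c).primeFactors.card :=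
            mul_le_mul_of_nonneg_right (le_max_left _ _) (Nat.cast_nonneg _)
        _ ≤ max A 0 * W := mul_le_mul_of_nonneg_left hωR (le_max_right _ _)
    calc (c : ℝ) < C * Real.exp (A * (a * b * c).primeFactors.card) *
          ((rad a b c : ℕ) : ℝ) ^ (1 + ε) := hAC a b c habc
      _ ≤ C * Real.exp (max A 0 * W) * ((rad a b c : ℕ) : ℝ) ^ (1 + ε) := by gcongr
  · intro h ε hε
    obtain ⟨C, hC, hC'⟩ := (ABC_iff.mp h) ε hε
    refine ⟨0, C, hC, fun a b c habc => ?_⟩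
    simpa using hC' a b c habc

end Summit.ABC.ABC.Theorems.DeepRegimeABC
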